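import Summits.AtomisticToContinuum.Crystallization.Theses.MinMeanCycleStackingLock

/-!
# Line `birth` — birth-certificate skeleton (BC3) for crux `PeierlsKarpStability`
(item stmt-AtomisticToContinuum-12018, route `MinMeanCycleStackingLock`, rank 3; registrar
planner-skel-stmt-AtomisticToContinuum-12018-0, 2026-08-17)

Crux (by name, the route decl
`Summit.AtomisticToContinuum.Crystallization.Theses.MinMeanCycleStackingLock.PeierlsKarpStability`):
under a min-mean-cycle certificate `(L, E, u, λ, g)` for couplings `J` with `Σ k|J_k| < ∞` and
`g ≥ 2T`, `T = Σ_{k>L+1}(k+|E|+1)|J_k|`, SOME periodic sequence all of whose `(L+1)`-windows lie in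
`E` minimises `haggStackingEnergy J` over all Hägg sequences.

## The line (Peierls lower bound ⇒ locked minimiser)

* `stub_peierlsLowerBound` — the PEIERLS LOWER BOUND in finite volume: under the certificate
  hypotheses there are an `E`-periodic `w` (period `p > 0`, every window in `E`) and a constant `C`
  with `n · e(J,w) ≤ H_n(J,s) + C` for every Hägg sequence `s` and every `n`
  (`e = haggStackingEnergy`, `H_n = haggEnergy n`).  This is the route's quantitative locking
  inequality with the non-negative defect term `(g − 2T)·#{bad windows}` dropped: it follows from
  the LANDED support item `LockedPhaseDefectBound` (stmt-12024,
  `Theorems/MinMeanCycleStackingLockLockedPhaseDefectBound.lean`, `lockedPhaseDefectBound_proof`)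
  in a few lines (`2T ≤ g` is hypothesis 8, the count is `≥ 0`); from scratch it is the whole
  Peierls–Karp telescoping + cycle-corrector argument (size M).
* `stub_le_haggStackingEnergy` — the LIMINF BOOKKEEPING: for couplings with `Σ k|J_k| < ∞`, a
  linear lower bound `n·e ≤ H_n(J,s) + C` (all `n`) forces `e ≤ haggStackingEnergy J s`
  (`= liminf H_n/n`).  Content: `H_n/n` is bounded above by `Σ'|J_k|` (so the `liminf` is not a
  junk `sSup`), and `H_n/n ≥ e − C/n` eventually exceeds `e − ε` (`Filter.le_liminf_of_le`).
  Size S–M, pure real analysis over `HaggStacking.lean`.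
* Composition `PeierlsKarpStability_of_stubs : <stub₁-sig> → <stub₂-sig> → Crux` (sorry-free;
  `Crux` is an `abbrev` for the route decl, so this is literally `stubs → PeierlsKarpStability`):
  the `w` of stub 1 is a Hägg sequence (its window at `m` lies in `E`, whose words are `±1`-valued
  by hypothesis 6, read at index `0`), it lies in the range, and for every Hägg `s` stub 2 applied
  to stub 1's bound gives `e(J,w) ≤ e(J,s)` — i.e. `IsLeast`.
* `PeierlsKarpStability_of : PeierlsKarpStability` — the crux BY NAME from the two stubs (the
  theorem `ledger skeleton check` keys on; its only `sorry`s are the two stubs').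

Disproof used: no `Cruxes/PeierlsKarpStability/Disproof.lean` exists at registration time
(`ledger crux ls` empty); the refuter crux-attack (evidence EVIDENCE.md / Witness.lean /
Degenerate.lean / Mutation.lean on the item, 2026-08-15) found the statement TRUE on paper, the
continuation clause load-bearing (it is used by stub 1, through the successor permutation of `E`),
and 0/1800 finite-model violations.  No stub restates the crux or the summit: stub 1 concludes a
finite-volume inequality (no `liminf`, no `IsLeast`), stub 2 is a statement about one fixed
sequence with no certificate in it (BC3 probes `stub → crux`, `stub → Crystallization` by
`first | exact? | simpa | aesop` fail, see the registrar's NOTES.md).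
-/

noncomputable section

open Filter Finset
open scoped BigOperators Topology

namespace Summit.AtomisticToContinuum.Crystallization.Cruxes.PeierlsKarpStability.Birth

/-- The crux BY NAME (an `abbrev`, used only as the conclusion of the hypotheses-form
composition `PeierlsKarpStability_of_stubs`). -/
abbrev Crux : Prop :=
  Summit.AtomisticToContinuum.Crystallization.Theses.MinMeanCycleStackingLock.PeierlsKarpStability

/-! ## Registered stubs -/

/-- **Stub 1 — Peierls lower bound in finite volume.** Under the certificate hypotheses of the
crux there are an `E`-periodic `w` and a constant `C` with `n · e(J,w) ≤ H_n(J,s) + C` for every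
Hägg sequence `s` and every `n`.  (Corollary of the landed `LockedPhaseDefectBound`,
`lockedPhaseDefectBound_proof`: drop the non-negative defect term.) -/
theorem stub_peierlsLowerBound :
    ∀ (J : ℕ → ℝ) (L : ℕ) (E : Finset (Fin (L + 1) → ℤ)) (u : (Fin L → ℤ) → ℝ) (lam g : ℝ),
      Summable (fun k : ℕ => (k : ℝ) * |J k|) → E.Nonempty →
      (∀ x ∈ E, ∀ y ∈ E, (fun i : Fin L => x (Fin.castSucc i)) = (fun i : Fin L => y (Fin.castSucc i)) → x = y) →
      (∀ x ∈ E, ∀ y ∈ E, (fun i : Fin L => x (Fin.succ i)) = (fun i : Fin L => y (Fin.succ i)) → x = y) →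
      (∀ x ∈ E, ∃ y ∈ E, (fun i : Fin L => y (Fin.castSucc i)) = (fun i : Fin L => x (Fin.succ i))) →
      (∀ x ∈ E, (∀ i, x i = 1 ∨ x i = -1) ∧ (∑ k ∈ Finset.Icc 2 (L + 1), if (∑ i : Fin (L + 1), if (i : ℕ) < k then x i else 0) % 3 = 0 then J k else 0) - lam + u (fun i : Fin L => x (Fin.castSucc i)) - u (fun i : Fin L => x (Fin.succ i)) = 0) →
      (∀ x : Fin (L + 1) → ℤ, (∀ i, x i = 1 ∨ x i = -1) → x ∉ E → g ≤ (∑ k ∈ Finset.Icc 2 (L + 1), if (∑ i : Fin (L + 1), if (i : ℕ) < k then x i else 0) % 3 = 0 then J k else 0) - lam + u (fun i : Fin L => x (Fin.castSucc i)) - u (fun i : Fin L => x (Fin.succ i))) →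
      2 * (∑' k : ℕ, if L + 1 < k then ((k : ℝ) + E.card + 1) * |J k| else 0) ≤ g →
      ∃ (w : ℤ → ℤ) (p : ℕ) (C : ℝ), 0 < p ∧ (∀ i, w (i + p) = w i) ∧
        (∀ m : ℤ, (fun i : Fin (L + 1) => w (m + ((i : ℕ) : ℤ))) ∈ E) ∧
        ∀ (s : ℤ → ℤ) (n : ℕ), Literature.MathematicalPhysics.StatisticalMechanics.IsHaggSeq s →
          (n : ℝ) * Literature.MathematicalPhysics.StatisticalMechanics.haggStackingEnergy J w ≤
            Literature.MathematicalPhysics.StatisticalMechanics.haggEnergy n J s + C := by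
  sorry

/-- **Stub 2 — a linear finite-volume lower bound passes to the stacking energy density.** For
couplings with `Σ k|J_k| < ∞`, if `n · e ≤ H_n(J,s) + C` for all `n` then
`e ≤ haggStackingEnergy J s = liminf_n H_n(J,s)/n` (`H_n/n ≤ Σ'|J_k|` keeps the `liminf` honest;
`H_n/n ≥ e − C/n`). -/
theorem stub_le_haggStackingEnergy :
    ∀ (J : ℕ → ℝ) (s : ℤ → ℤ) (e C : ℝ), Summable (fun k : ℕ => (k : ℝ) * |J k|) →
      (∀ n : ℕ, (n : ℝ) * e ≤ Literature.MathematicalPhysics.StatisticalMechanics.haggEnergy n J s + C) →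
      e ≤ Literature.MathematicalPhysics.StatisticalMechanics.haggStackingEnergy J s := by
  sorry

/-! ## Composition (sorry-free) -/

/-- **The stub STATEMENTS imply the crux** (hypotheses = the two stub signatures verbatim,
conclusion = `Crux`, the route decl): the `E`-periodic `w` of the Peierls bound is a Hägg sequence
and, by the `liminf` bookkeeping, a minimiser of the stacking energy density. -/
theorem PeierlsKarpStability_of_stubs
    (hA : ∀ (J : ℕ → ℝ) (L : ℕ) (E : Finset (Fin (L + 1) → ℤ)) (u : (Fin L → ℤ) → ℝ) (lam g : ℝ),
      Summable (fun k : ℕ => (k : ℝ) * |J k|) → E.Nonempty →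
      (∀ x ∈ E, ∀ y ∈ E, (fun i : Fin L => x (Fin.castSucc i)) = (fun i : Fin L => y (Fin.castSucc i)) → x = y) →
      (∀ x ∈ E, ∀ y ∈ E, (fun i : Fin L => x (Fin.succ i)) = (fun i : Fin L => y (Fin.succ i)) → x = y) →
      (∀ x ∈ E, ∃ y ∈ E, (fun i : Fin L => y (Fin.castSucc i)) = (fun i : Fin L => x (Fin.succ i))) →
      (∀ x ∈ E, (∀ i, x i = 1 ∨ x i = -1) ∧ (∑ k ∈ Finset.Icc 2 (L + 1), if (∑ i : Fin (L + 1), if (i : ℕ) < k then x i else 0) % 3 = 0 then J k else 0) - lam + u (fun i : Fin L => x (Fin.castSucc i)) - u (fun i : Fin L => x (Fin.succ i)) = 0) →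
      (∀ x : Fin (L + 1) → ℤ, (∀ i, x i = 1 ∨ x i = -1) → x ∉ E → g ≤ (∑ k ∈ Finset.Icc 2 (L + 1), if (∑ i : Fin (L + 1), if (i : ℕ) < k then x i else 0) % 3 = 0 then J k else 0) - lam + u (fun i : Fin L => x (Fin.castSucc i)) - u (fun i : Fin L => x (Fin.succ i))) →
      2 * (∑' k : ℕ, if L + 1 < k then ((k : ℝ) + E.card + 1) * |J k| else 0) ≤ g →
      ∃ (w : ℤ → ℤ) (p : ℕ) (C : ℝ), 0 < p ∧ (∀ i, w (i + p) = w i) ∧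
        (∀ m : ℤ, (fun i : Fin (L + 1) => w (m + ((i : ℕ) : ℤ))) ∈ E) ∧
        ∀ (s : ℤ → ℤ) (n : ℕ), Literature.MathematicalPhysics.StatisticalMechanics.IsHaggSeq s →
          (n : ℝ) * Literature.MathematicalPhysics.StatisticalMechanics.haggStackingEnergy J w ≤
            Literature.MathematicalPhysics.StatisticalMechanics.haggEnergy n J s + C)
    (hB : ∀ (J : ℕ → ℝ) (s : ℤ → ℤ) (e C : ℝ), Summable (fun k : ℕ => (k : ℝ) * |J k|) →
      (∀ n : ℕ, (n : ℝ) * e ≤ Literature.MathematicalPhysics.StatisticalMechanics.haggEnergy n J s + C) →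
      e ≤ Literature.MathematicalPhysics.StatisticalMechanics.haggStackingEnergy J s) :
    Crux := by
  unfold Crux Summit.AtomisticToContinuum.Crystallization.Theses.MinMeanCycleStackingLock.PeierlsKarpStability
  intro J L E u lam g hJ hE hpre hsuf hcont hzero hgap hg
  obtain ⟨w, p, C, hp, hper, hwin, hbound⟩ := hA J L E u lam g hJ hE hpre hsuf hcont hzero hgap hg
  -- `w` is a Hägg sequence: its window at `m` lies in `E`, whose words are `±1`-valued (index `0`)
  have hw : Literature.MathematicalPhysics.StatisticalMechanics.IsHaggSeq w := by
    intro m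
    have h := (hzero _ (hwin m)).1 0
    simpa using h
  refine ⟨w, p, hp, hper, hwin, ⟨⟨w, hw⟩, rfl⟩, ?_⟩
  -- lower bound: for every Hägg `s`, `n · e(J,w) ≤ H_n(J,s) + C` for all `n`, hence `e(J,w) ≤ e(J,s)`
  rintro _ ⟨⟨s, hs⟩, rfl⟩
  exact hB J s _ C hJ fun n => hbound s n hs

/-- **The crux BY NAME** from the two registered stubs (the skeleton theorem; its `sorry`s are
exactly `stub_peierlsLowerBound` and `stub_le_haggStackingEnergy`). -/
theorem PeierlsKarpStability_of :
    Summit.AtomisticToContinuum.Crystallization.Theses.MinMeanCycleStackingLock.PeierlsKarpStability :=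
  PeierlsKarpStability_of_stubs stub_peierlsLowerBound stub_le_haggStackingEnergy

end Summit.AtomisticToContinuum.Crystallization.Cruxes.PeierlsKarpStability.Birth

end
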